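import Summits.Ventures.DiscreteObjects.PP12.FlagTenPhiChar
import Summits.Ventures.DiscreteObjects.PP12.FlagTenPhiInjective

/-!
# The `f = 10` flag-cell orbit data: equation (C1) at subtype level (kernel; Step D, conjunct 6 of `IsFlagTenOrbitMatrix` before transport)
Framing: lottery ticket; floor = certified bounds/negative ranges.

Cell pub-namedobj (venture DiscreteObjects), target (M), designs gen 13 (HOME FAMILY-FLAG7X §7c). Setting as in `FlagTenOrbitDataOfPlane`.
For two vertices `x ≠ x'` (points `≠ c` of the non-fixed line `u₀ ∋ c`):
`#{y fixed, y ≠ c : cOrb y x = cOrb y x'} = if phiVertex x = x' ∨ phiVertex x' = x then 0 else 2` (**`vertex_pair_count`**),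
i.e. conjunct 6 `#{k : C k i = C k i'} = if (φ i = i' ∨ φ i' = i) then 0 else 2` before transport. It is the plane-level identity
`OrbitSideIdentities.vertex_vertex_identity` (λ = 1 for the lines `e = σ²(x·σx) ∋ x` and `e' ∋ x'`), with the lines through `x` sorted into
the c-line `u₀` (always counted), the T-lines `x·y` (counted iff the two `C`-orbits agree), the own sides (excluded) and the foreign side of `x`
(never counted: by `phiVertex_eq_iff` and `phiVertex_injective`), and the side terms evaluated by `FlagTenPhiChar.card_sides_through`.
No `sorry`, no new axioms.
-/

namespace Summit.Ventures.DiscreteObjects.PP12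

open Configuration Finset
open scoped Classical

namespace Collineation

variable {P L : Type*} [Membership P L] [ProjectivePlane P L] [Fintype P] [Fintype L] (σ : Collineation P L)

section Flag

variable {l : L} {c : P} (hl : σ.onLines l = l) (hc : σ.onPoints c = c) (hcl : c ∈ l)
  (hP : ∀ p : P, σ.onPoints p = p → p ∈ l) (hL : ∀ m : L, σ.onLines m = m → c ∈ m)
  (h12 : ProjectivePlane.order P L = 12)

include hl hc hcl hP hL h12 in
/-- **(C1) at subtype level** (`f = 10`): see the module docstring. -/
theorem vertex_pair_count (hq : σ.onPoints ^ 3 = 1) (hf : fixedCard σ.onPoints = 10) {u₀ : L} (hcu₀ : c ∈ u₀) (hu₀ : σ.onLines u₀ ≠ u₀)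
    {x x' : P} (hxu : x ∈ u₀) (hxc : x ≠ c) (hx'u : x' ∈ u₀) (hx'c : x' ≠ c) (hxx' : x ≠ x') :
    (univ.filter fun y : P => σ.onPoints y = y ∧ y ≠ c ∧ σ.cOrb l y x = σ.cOrb l y x').card
      = if σ.phiVertex l c u₀ x = x' ∨ σ.phiVertex l c u₀ x' = x then 0 else 2 := by
  have hqL : σ.onLines ^ 3 = 1 := σ.onLines_pow_eq_one hq
  have hxX := σ.exterior_of_mem_cline hL hcu₀ hu₀ hxu hxc
  have hx'X := σ.exterior_of_mem_cline hL hcu₀ hu₀ hx'u hx'c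
  have hxf : σ.onPoints x ≠ x := σ.not_fixed_of_exterior_flag hl hP hxX
  have hx'f : σ.onPoints x' ≠ x' := σ.not_fixed_of_exterior_flag hl hP hx'X
  obtain ⟨hxa, hσxa⟩ := σ.sideOf_spec l hxf
  obtain ⟨-, ha0⟩ := σ.side_no_fixed_point hxf hxX hxa hσxa
  obtain ⟨hx'a', hσx'a'⟩ := σ.sideOf_spec l hx'f
  obtain ⟨-, ha0'⟩ := σ.side_no_fixed_point hx'f hx'X hx'a' hσx'a'
  have h3 := apply_three σ.onPoints hq
  have h3L := apply_three σ.onLines hqL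
  -- the two vertex/side-orbit pairs: e = σ²(x·σx) ∋ x with σe ∋ x, and e' likewise for x'
  set e : L := σ.onLines (σ.onLines (σ.sideOf l x)) with he_def
  set e' : L := σ.onLines (σ.onLines (σ.sideOf l x')) with he'_def
  have hxe : x ∈ e := by have := σ.mem_map (σ.mem_map hσxa); rw [h3] at this; exact this
  have hxσe : x ∈ σ.onLines e := by rw [he_def, h3L]; exact hxa
  have hx'e' : x' ∈ e' := by have := σ.mem_map (σ.mem_map hσx'a'); rw [h3] at this; exact this
  have hx'σe' : x' ∈ σ.onLines e' := by rw [he'_def, h3L]; exact hx'a'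
  have heo : orb3 σ.onLines e = orb3 σ.onLines (σ.sideOf l x) :=
    orb3_eq_of_mem σ.onLines hqL ((mem_orb3 _ _ _).2 (Or.inr (Or.inr rfl)))
  have he'o : orb3 σ.onLines e' = orb3 σ.onLines (σ.sideOf l x') :=
    orb3_eq_of_mem σ.onLines hqL ((mem_orb3 _ _ _).2 (Or.inr (Or.inr rfl)))
  have hne_e : σ.onLines e ≠ e := by
    intro h'; exact (σ.orb3_side_noFixed ha0 ((mem_orb3 _ _ _).2 (Or.inr (Or.inr rfl)))) c hc (hL e h')
  have hne_e' : σ.onLines e' ≠ e' := by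
    intro h'; exact (σ.orb3_side_noFixed ha0' ((mem_orb3 _ _ _).2 (Or.inr (Or.inr rfl)))) c hc (hL e' h')
  -- the two triangles differ (u₀ meets each orbit once), hence so do their side orbits
  have hx'nx : x' ∉ orb3 σ.onPoints x := fun h' => hxx' (σ.vertex_eq_of_mem_orb3 hc hq hcu₀ hu₀ hx'u hxu h').symm
  have hee' : orb3 σ.onLines e ≠ orb3 σ.onLines e' := by
    intro h'
    have hmem : σ.sideOf l x' ∈ orb3 σ.onLines (σ.sideOf l x) := by rw [← heo, h', he'o]; exact self_mem_orb3 _ _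
    obtain ⟨R, hRx, hRg, hσRg⟩ := σ.side_of_mem_orb3_sideOf hq hxf hmem
    have hRX := σ.exterior_of_mem_orb3 hxX hRx
    have hx'R : x' = R := σ.side_unique hRX hRg hσRg hx'a' hσx'a'
    exact hx'nx (by rw [hx'R]; exact hRx)
  have hx0 : ∀ g : L, x ∈ g → σ.onLines g ≠ g := fun g hxg hg => hxX g hg hxg
  have hid := σ.vertex_vertex_identity hq hne_e hne_e' hee' hxf hxe hxσe hx0 hx'f hx'e' hx'σe'
  rw [heo, he'o, σ.card_sides_through hl hc hcl hP hL h12 hq hf hcu₀ hu₀ hx'u hx'c hxu hxc hxx'.symm,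
    σ.card_sides_through hl hc hcl hP hL h12 hq hf hcu₀ hu₀ hxu hxc hx'u hx'c hxx'] at hid
  -- the third term: u₀ together with the T-lines x·y whose orbit reaches x'
  set N : Finset P := univ.filter fun y : P => σ.onPoints y = y ∧ y ≠ c ∧ σ.cOrb l y x = σ.cOrb l y x' with hN
  set R : Finset L := univ.filter fun g : L => x ∈ g ∧ g ∉ orb3 σ.onLines (σ.sideOf l x) ∧ g ∉ orb3 σ.onLines (σ.sideOf l x') ∧
      ∃ g' ∈ orb3 σ.onLines g, x' ∈ g' with hR_def
  have hyσ : ∀ {y : P}, σ.onPoints y = y → ∀ g : L, y ∈ g → y ∈ σ.onLines g := fun hy g hg => by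
    have := σ.mem_map hg; rwa [hy] at this
  have notside : ∀ {g : L} {y : P}, σ.onPoints y = y → y ∈ g →
      g ∉ orb3 σ.onLines (σ.sideOf l x) ∧ g ∉ orb3 σ.onLines (σ.sideOf l x') := fun hy hyg =>
    ⟨fun h' => σ.orb3_side_noFixed ha0 h' _ hy hyg, fun h' => σ.orb3_side_noFixed ha0' h' _ hy hyg⟩
  have hRdesc : R = insert u₀ (N.image fun y => lineThrough l x y) := by
    ext g
    rw [hR_def, mem_filter, mem_insert, mem_image]
    constructor
    · rintro ⟨-, hxg, hg1, hg2, g', hg', hx'g'⟩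
      by_cases hcg : c ∈ g
      · left; exact (Nondegenerate.eq_or_eq hxg hcg hxu hcu₀).resolve_left hxc
      · right
        by_cases hfix : ∃ y : P, σ.onPoints y = y ∧ y ∈ g
        · -- a T-line x·y: its orbit consists of lines through y, so it reaches x' iff x'·y is in it
          obtain ⟨y, hy, hyg⟩ := hfix
          have hyc : y ≠ c := fun e0 => hcg (e0 ▸ hyg)
          have hxy : x ≠ y := fun e0 => hxf (by rw [e0, hy])
          have hx'y : x' ≠ y := fun e0 => hx'f (by rw [e0, hy])
          obtain ⟨hxk, hyk⟩ := lineThrough_spec l hxy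
          obtain ⟨hx'k', hyk'⟩ := lineThrough_spec l hx'y
          have hgk : g = lineThrough l x y := (Nondegenerate.eq_or_eq hxg hyg hxk hyk).resolve_left hxy
          have hyg' : y ∈ g' := by
            rw [mem_orb3] at hg'
            rcases hg' with rfl | rfl | rfl
            · exact hyg
            · exact hyσ hy _ hyg
            · exact hyσ hy _ (hyσ hy _ hyg)
          have hg'k' : g' = lineThrough l x' y := (Nondegenerate.eq_or_eq hx'g' hyg' hx'k' hyk').resolve_left hx'y
          refine ⟨y, ?_, hgk.symm⟩
          rw [hN, mem_filter]
          refine ⟨mem_univ _, hy, hyc, ?_⟩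
          change orb3 σ.onLines (lineThrough l x y) = orb3 σ.onLines (lineThrough l x' y)
          rw [← hgk, ← hg'k']
          exact (orb3_eq_of_mem σ.onLines hqL hg').symm
        · -- an exterior line through x outside the side orbit of x: the foreign side of x; its orbit cannot reach x'
          exfalso
          push Not at hfix
          have hg0 : ∀ p : P, σ.onPoints p = p → p ∉ g := fun p hp => hfix p hp
          have hσxg : σ.onPoints x ∉ g := fun h' =>
            hg1 (σ.mem_orb3_sideOf_of_side hq hxf (self_mem_orb3 _ _) hxf hxg h')
          have hσ2xg : σ.onPoints (σ.onPoints x) ∉ g := by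
            intro h'
            have hσ2f : σ.onPoints (σ.onPoints (σ.onPoints x)) ≠ σ.onPoints (σ.onPoints x) := by
              rw [h3]; exact fun e0 => (σ.sq_ne_of_cube hq hxf).1 e0.symm
            exact hg1 (σ.mem_orb3_sideOf_of_side hq hxf ((mem_orb3 _ _ _).2 (Or.inr (Or.inr rfl))) hσ2f h' (by rw [h3]; exact hxg))
          obtain ⟨F', -, huniq⟩ := σ.existsUnique_foreign_side hl hP h12 hq hf hxX
          obtain ⟨hxF, hF0, hF1, hF2⟩ := σ.foreignSide_spec hl hP h12 hq hf hxX
          have hgF : g = σ.foreignSide l x :=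
            (huniq g ⟨hxg, hg0, hσxg, hσ2xg⟩).trans (huniq _ ⟨hxF, hF0, hF1, hF2⟩).symm
          obtain ⟨hpu, hpc, ⟨Q, hQp, hQF, hσQF⟩, -⟩ := σ.phiVertex_spec hl hc hcl hP hL h12 hq hf hcu₀ hu₀ hxX
          set p := σ.phiVertex l c u₀ x with hp_def
          have hpX := σ.exterior_of_mem_cline hL hcu₀ hu₀ hpu hpc
          have hpf : σ.onPoints p ≠ p := σ.not_fixed_of_exterior_flag hl hP hpX
          have hQX := σ.exterior_of_mem_orb3 hpX hQp
          have hQf : σ.onPoints Q ≠ Q := σ.not_fixed_of_exterior_flag hl hP hQX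
          rw [← hgF] at hQF hσQF
          have hgo : g ∈ orb3 σ.onLines (σ.sideOf l p) := σ.mem_orb3_sideOf_of_side hq hpf hQp hQf hQF hσQF
          have hg'o : g' ∈ orb3 σ.onLines (σ.sideOf l p) := by
            rw [orb3_eq_of_mem σ.onLines hqL hgo] at hg'; exact hg'
          by_cases hpx' : p = x'
          · exact hg2 (by rw [← hpx']; exact hgo)
          · have hx'p : x' ≠ p := fun e0 => hpx' e0.symm
            have hφ := (σ.phiVertex_eq_iff hl hc hcl hP hL h12 hq hf hcu₀ hu₀ hx'u hx'c hpu hpc hx'p).2 ⟨g', hg'o, hx'g'⟩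
            have heq : σ.phiVertex l c u₀ x = σ.phiVertex l c u₀ x' := by rw [hφ]
            exact hxx' (σ.phiVertex_injective hl hc hcl hP hL h12 hq hf hcu₀ hu₀ hxu hxc hx'u hx'c heq)
    · rintro (hg | ⟨y, hyN, hg⟩)
      · rw [hg]
        exact ⟨mem_univ _, hxu, fun h' => σ.orb3_side_noFixed ha0 h' c hc hcu₀, fun h' => σ.orb3_side_noFixed ha0' h' c hc hcu₀,
          u₀, self_mem_orb3 _ _, hx'u⟩
      · rw [hN, mem_filter] at hyN
        obtain ⟨-, hy, hyc, hC⟩ := hyN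
        have hxy : x ≠ y := fun e0 => hxf (by rw [e0, hy])
        have hx'y : x' ≠ y := fun e0 => hx'f (by rw [e0, hy])
        obtain ⟨hxk, hyk⟩ := lineThrough_spec l hxy
        obtain ⟨hx'k', hyk'⟩ := lineThrough_spec l hx'y
        rw [← hg]
        refine ⟨mem_univ _, hxk, (notside hy hyk).1, (notside hy hyk).2, lineThrough l x' y, ?_, hx'k'⟩
        change orb3 σ.onLines (lineThrough l x y) = orb3 σ.onLines (lineThrough l x' y) at hC
        rw [hC]
        exact self_mem_orb3 _ _
  -- counting: u₀ is not a T-line, and y ↦ x·y is injective on the fixed points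
  have hu₀nim : u₀ ∉ N.image (fun y => lineThrough l x y) := by
    rw [mem_image]
    rintro ⟨y, hyN, hk⟩
    rw [hN, mem_filter] at hyN
    obtain ⟨-, hy, hyc, -⟩ := hyN
    have hxy : x ≠ y := fun e0 => hxf (by rw [e0, hy])
    have hyu : y ∈ u₀ := by rw [← hk]; exact (lineThrough_spec l hxy).2
    exact hu₀ (((Nondegenerate.eq_or_eq hyu hcu₀ (hP y hy) hcl).resolve_left hyc) ▸ hl)
  have hinj : Set.InjOn (fun y => lineThrough l x y) ↑N := by
    intro y₁ hy₁ y₂ hy₂ hk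
    rw [mem_coe, hN, mem_filter] at hy₁ hy₂
    obtain ⟨-, hy₁', -, -⟩ := hy₁
    obtain ⟨-, hy₂', -, -⟩ := hy₂
    have hxy₁ : x ≠ y₁ := fun e0 => hxf (by rw [e0, hy₁'])
    have hxy₂ : x ≠ y₂ := fun e0 => hxf (by rw [e0, hy₂'])
    obtain ⟨hxk₁, hy₁k⟩ := lineThrough_spec l hxy₁
    obtain ⟨-, hy₂k⟩ := lineThrough_spec l hxy₂
    have hk' : lineThrough l x y₁ = lineThrough l x y₂ := hk
    rw [← hk'] at hy₂k
    by_contra hne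
    have hkl : lineThrough l x y₁ = l := (Nondegenerate.eq_or_eq hy₁k hy₂k (hP y₁ hy₁') (hP y₂ hy₂')).resolve_left hne
    exact hxX l hl (hkl ▸ hxk₁)
  have hRcard : R.card = N.card + 1 := by
    rw [hRdesc, card_insert_of_notMem hu₀nim, card_image_of_injOn hinj]
  rw [hRcard] at hid
  by_cases hB : σ.phiVertex l c u₀ x = x'
  · rw [if_pos hB] at hid
    rw [if_pos (Or.inl hB)]
    by_cases hA : σ.phiVertex l c u₀ x' = x
    · rw [if_pos hA] at hid; omega
    · rw [if_neg hA] at hid; omega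
  · rw [if_neg hB] at hid
    by_cases hA : σ.phiVertex l c u₀ x' = x
    · rw [if_pos hA] at hid
      rw [if_pos (Or.inr hA)]
      omega
    · rw [if_neg hA] at hid
      rw [if_neg (not_or.2 ⟨hB, hA⟩)]
      omega

end Flag

end Collineation

end Summit.Ventures.DiscreteObjects.PP12
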